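import Summits.KontsevichZagierPeriods.KontsevichZagierPeriods.Theorems.RootDecompWalshStrataBall4Rung
import Summits.KontsevichZagierPeriods.KontsevichZagierPeriods.Theorems.RootDecompWalshStrataBall4Disc
import Summits.KontsevichZagierPeriods.KontsevichZagierPeriods.Theorems.RootDecompQuadraticDescentLegendrePairs

/-!
# The decomposable corner of the weight-two wall, typed

Route `RootDecompWalshStrata` (cell decomp-kz, lens 4, gen 11), support toward `QuadricSignKernel`
(item stmt-KontsevichZagierPeriods-25393).  The `d = 4` node is
`QuadricFour ⟸ RationalTwoKernel ∧ QuadricTwoDescent`; the weight-ONE cells (paraboloid, cone, cylinders)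
never touch the oracle (`RootDecompWalshStrataBakerFourRung`).  This file isolates what the oracle is asked
on the first weight-TWO specimen, the 4-ball.  The DECOMPOSABLE SECTOR `D₂` is the subgroup of
`KZ.FormalRep` generated by the Baker generators `[N]` (`dim N ≤ 1`, `N` rational) AND the products
`[N₁]·[N₂]` of two of them (`decompGens`); `DecomposableTwoKernel` = Conjecture 1 in kernel form on `D₂`
(trivially implied by `RationalTwoKernel`: a product of two rational `≤ 1`-cells is a rational `≤ 2`-cell).
THE BALL LIVES THERE, INSIDE THE RULES: `[(0,1)⁴ ∩ {Σxᵢ² < 1}, q] − [arc, 1]·[arc, q/2] ∈ KZ.relations`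
with `arcRep w = [(0,1), w/(2((1−t)²+t²))]` (`decompDescentAt_ball4`), so the kernel statement for every
family of ball cells follows from `DecomposableTwoKernel` ALONE (`sum_mem_relations_ball4_of_decompKernel`).
VALUE SIDE (not formalised here; the idea-needed leaf, stated precisely): the values of `decompGens` are
the Baker module `B = ℚ + ℚπ + Σ ℚ log αᵢ` and its pairwise products `B·B`; `DecomposableTwoKernel` is
«the tensor square of the dimension-one normal form» + «the monomials of degree ≤ 2 in a multiplicatively
independent family of logarithms (and `2πi`) are `ℚ`-linearly independent» — a consequence of Schanuel's
conjecture whose simplest instance is the FOUR EXPONENTIALS CONJECTURE (`log α₁·log β₂ ≠ log α₂·log β₁`;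
open — the six exponentials version is Lang–Ramachandra), and whose instance for the ball is
«`π² ∉ ℚ + ℚπ + Σ ℚ log αᵢ`».  0 sorry.
[KontsevichZagier2001 §1.2, §4.1; Baker1975 Ch. 12 Thm 12.3, p. 112 (Schanuel); NesterenkoPhilippon2001
Ch. 15 Conj. 2.3 (four exponentials); this node]
-/

noncomputable section

open Literature.NumberTheory.Transcendental
open MeasureTheory Set
open MvPolynomial (aeval X C)
open Summit.KontsevichZagierPeriods.RootDecompWalshStrata.WalshSpanProof (cellRep cellRep_domain
  cellRep_integrand)
open Summit.KontsevichZagierPeriods.RootDecompWalshStrata.Ball4 (ball4Poly sqSet sqRep sqRep_domain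
  sqRep_integrand ivSet arcRep arcRep_domain arcRep_integrand isRational_arcRep half_le_gq
  of_cell_sub_of_sqRep_mem_relations)
open Summit.KontsevichZagierPeriods.RootDecompWalshStrata.QuadricFourRung (RationalTwoKernel
  QuadricTwoDescentFourAt totalDegree_ball4Poly_le)
open Summit.KontsevichZagierPeriods.KontsevichZagierPeriods.Theorems.RootDecompQuadraticDescentLegendre
  (isRational_prod)

namespace Summit.KontsevichZagierPeriods.RootDecompWalshStrata.DecompTwo

/-! #### The decomposable sector `D₂` and its kernel statement -/

/-- The Baker generators: classes of KZ-rational representations of dimension `≤ 1`. [definition] -/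
def bakerGens : Set KZ.FormalRep :=
  {y | ∃ (m : ℕ) (N : KZ.IntegralRep m), m ≤ 1 ∧ N.IsRational ∧ y = KZ.of N}

/-- The decomposable generators: Baker generators and products of two of them. [definition] -/
def decompGens : Set KZ.FormalRep :=
  bakerGens ∪ {y | ∃ (m₁ m₂ : ℕ) (N₁ : KZ.IntegralRep m₁) (N₂ : KZ.IntegralRep m₂),
    m₁ ≤ 1 ∧ m₂ ≤ 1 ∧ N₁.IsRational ∧ N₂.IsRational ∧ y = KZ.of N₁ * KZ.of N₂}

/-- **`DecomposableTwoKernel`** — Conjecture 1 in kernel form on the DECOMPOSABLE sector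
`D₂ = ⟨[N], [N₁]·[N₂] : dim ≤ 1, rational⟩`: every vanishing `ℤ`-combination in `D₂` is a relation.
The value-side content is «degree-≤ 2 monomials in independent logarithms and `2πi` are linearly
independent» (Schanuel ⇒ it; simplest instance: four exponentials).
[KontsevichZagier2001 §1.2; NesterenkoPhilippon2001 Ch. 15 Conj. 2.3] -/
@[conjecture] def DecomposableTwoKernel : Prop :=
  ∀ ⦃x : KZ.FormalRep⦄, x ∈ AddSubgroup.closure decompGens → KZ.eval x = 0 → x ∈ KZ.relations

/-- A product of two Baker generators is the class of a KZ-rational representation of dimension `≤ 2`;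
hence `decompGens` lies in the rational dimension-`≤ 2` sector. [KontsevichZagier2001 §4.1] -/
theorem decompGens_subset_two :
    decompGens ⊆ {y : KZ.FormalRep | ∃ (m : ℕ) (N : KZ.IntegralRep m), m ≤ 2 ∧ N.IsRational ∧
      y = KZ.of N} := by
  rintro y (⟨m, N, hm, hN, rfl⟩ | ⟨m₁, m₂, N₁, N₂, h₁, h₂, hN₁, hN₂, rfl⟩)
  · exact ⟨m, N, hm.trans one_le_two, hN, rfl⟩
  · exact ⟨m₁ + m₂, N₁.prod N₂, by omega, isRational_prod hN₁ hN₂, KZ.of_mul_of N₁ N₂⟩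

/-- **`RationalTwoKernel → DecomposableTwoKernel`** (the decomposable corner is a sub-question of the
oracle). [KontsevichZagier2001 §1.2] -/
theorem decomposableTwoKernel_of_rationalTwoKernel (hK : RationalTwoKernel) :
    DecomposableTwoKernel :=
  fun _ hx hv => hK (AddSubgroup.closure_mono decompGens_subset_two hx) hv

/-! #### Kernel transfer along a descent (pure algebra) -/

/-- **Kernel transfer.** If every cell `ρᵢ` of a vanishing `ℤ`-combination descends modulo relations to
`yᵢ` in a sector on which Conjecture 1 (kernel form) holds, the combination is a relation.
[KontsevichZagier2001 §1.2] -/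
theorem sum_mem_relations_of_descent {S : Set KZ.FormalRep}
    (hK : ∀ ⦃x : KZ.FormalRep⦄, x ∈ AddSubgroup.closure S → KZ.eval x = 0 → x ∈ KZ.relations)
    (k : ℕ) (d : Fin k → ℕ) (ρ : (i : Fin k) → KZ.IntegralRep (d i)) (c : Fin k → ℤ)
    (y : Fin k → KZ.FormalRep) (hy : ∀ i, y i ∈ AddSubgroup.closure S)
    (hrel : ∀ i, KZ.of (ρ i) - y i ∈ KZ.relations) (hv : KZ.eval (∑ i, c i • KZ.of (ρ i)) = 0) :
    (∑ i, c i • KZ.of (ρ i)) ∈ KZ.relations := by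
  have h1 : (∑ i, c i • KZ.of (ρ i)) - ∑ i, c i • y i ∈ KZ.relations := by
    rw [← Finset.sum_sub_distrib]
    exact AddSubgroup.sum_mem _ fun i _ => by
      rw [← smul_sub]; exact AddSubgroup.zsmul_mem _ (hrel i) _
  have h2 : (∑ i, c i • y i) ∈ AddSubgroup.closure S :=
    AddSubgroup.sum_mem _ fun i _ => AddSubgroup.zsmul_mem _ (hy i) _
  have h3 : KZ.eval (∑ i, c i • y i) = 0 := by
    have h := KZ.relations_le_ker_eval_holds h1
    rw [AddMonoidHom.mem_ker, map_sub, hv, zero_sub, neg_eq_zero] at h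
    exact h
  simpa using KZ.relations.add_mem h1 (hK h2 h3)

/-! #### The per-quadric decomposable descent -/

/-- **`QuadricDecompDescentAt P`:** every constant-weight cell `[(0,1)⁴ ∩ {P > 0}, q]` (`deg P ≤ 2`)
descends modulo `KZ.relations` into the decomposable sector `D₂`. [KontsevichZagier2001 §1.2; this node] -/
@[conjecture] def QuadricDecompDescentAt (P : MvPolynomial (Fin 4) ℚ) : Prop :=
  ∀ (q : ℚ) (ρ : KZ.IntegralRep 4),
    (ρ.domain = {x | (∀ j, 0 < x j ∧ x j < 1) ∧ 0 < MvPolynomial.aeval x P} ∧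
      ∀ x ∈ ρ.domain, ρ.integrand x = (q : ℝ)) → P.totalDegree ≤ 2 →
    ∃ y ∈ AddSubgroup.closure decompGens, KZ.of ρ - y ∈ KZ.relations

/-- Decomposable descent is a special case of descent to the rational dimension-`≤ 2` sector.
[KontsevichZagier2001 §1.2] -/
theorem twoDescentFourAt_of_decompDescentAt {P : MvPolynomial (Fin 4) ℚ}
    (h : QuadricDecompDescentAt P) : QuadricTwoDescentFourAt P := by
  intro q ρ hρ hdeg
  obtain ⟨y, hy, hrel⟩ := h q ρ hρ hdeg
  exact ⟨y, AddSubgroup.closure_mono decompGens_subset_two hy, hrel⟩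

/-- Descent to the Baker sector is decomposable descent (`bakerGens ⊆ decompGens`): the weight-one
class joins.  The hypothesis is literally `BakerAt.QuadricBakerDescentAt P` (part 87), unfolded here to
keep this file's imports landed. [KontsevichZagier2001 §1.2] -/
theorem decompDescentAt_of_bakerDescent {P : MvPolynomial (Fin 4) ℚ}
    (h : ∀ (q : ℚ) (ρ : KZ.IntegralRep 4),
      (ρ.domain = {x | (∀ j, 0 < x j ∧ x j < 1) ∧ 0 < MvPolynomial.aeval x P} ∧
        ∀ x ∈ ρ.domain, ρ.integrand x = (q : ℝ)) → P.totalDegree ≤ 2 →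
      ∃ y ∈ AddSubgroup.closure
        {y : KZ.FormalRep | ∃ (m : ℕ) (N : KZ.IntegralRep m), m ≤ 1 ∧ N.IsRational ∧ y = KZ.of N},
        KZ.of ρ - y ∈ KZ.relations) :
    QuadricDecompDescentAt P := by
  intro q ρ hρ hdeg
  obtain ⟨y, hy, hrel⟩ := h q ρ hρ hdeg
  exact ⟨y, AddSubgroup.closure_mono (fun z hz => Or.inl hz) hy, hrel⟩

/-- **Conjecture 1 (kernel form) for MIXED families of decomposably-descending quadric 4-cells (balls
together with every weight-one cell: paraboloids, cones, cylinders, their orbits), given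
`DecomposableTwoKernel` only.**  SCOPE: for a family supported on ONE domain of non-zero volume the
kernel statement is formal (integrand additivity: `Σ cᵢ[C, qᵢ] ∼ [C, Σ cᵢqᵢ] = [C, 0]`); the content is
in families mixing DIFFERENT domains, and in the descent theorems themselves.
[KontsevichZagier2001 §1.2; this node] -/
theorem sum_mem_relations_four_of_decompDescentAt (hD : DecomposableTwoKernel) (k : ℕ)
    (P : Fin k → MvPolynomial (Fin 4) ℚ) (q : Fin k → ℚ) (ρ : Fin k → KZ.IntegralRep 4) (c : Fin k → ℤ)
    (hW : ∀ i, QuadricDecompDescentAt (P i))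
    (hρ : ∀ i, (ρ i).domain = {x | (∀ j, 0 < x j ∧ x j < 1) ∧ 0 < MvPolynomial.aeval x (P i)} ∧
      ∀ x ∈ (ρ i).domain, (ρ i).integrand x = (q i : ℝ))
    (hdeg : ∀ i, (P i).totalDegree ≤ 2) (hv : KZ.eval (∑ i, c i • KZ.of (ρ i)) = 0) :
    (∑ i, c i • KZ.of (ρ i)) ∈ KZ.relations := by
  choose y hy hrel using fun i => hW i (q i) (ρ i) (hρ i) (hdeg i)
  exact sum_mem_relations_of_descent hD k (fun _ => 4) ρ c y hy hrel hv

/-! #### The ball is decomposable inside the rules: `[B⁴₊, q] ≡ [arc, 1]·[arc, q/2]` -/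

/-- `(1 − v)² + v² > 0`. [folklore] -/
private theorem gPos (v : ℝ) : 0 < (1 - v) ^ 2 + v ^ 2 := one_half_pos.trans_le (half_le_gq v)

/-- The product `arcRep a ⊗ arcRep b` has the unit square as domain. [KontsevichZagier2001 §4.1] -/
theorem prod_arcRep_domain (a b : ℚ) : ((arcRep a).prod (arcRep b)).domain = sqSet := by
  rw [KZ.IntegralRep.prod_domain]
  ext z
  simp only [KZ.IntegralRep.mem_prodDomain, arcRep_domain, ivSet, sqSet, mem_setOf_eq]
  constructor
  · rintro ⟨h0, h1⟩ j
    fin_cases j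
    · exact h0 0
    · exact h1 0
  · intro h
    refine ⟨fun i => ?_, fun j => ?_⟩
    · fin_cases i
      exact h 0
    · fin_cases j
      exact h 1

/-- **`arcRep 1 ⊗ arcRep (q/2) − sqRep q ∈ KZ.relations`** (same domain; integrands agree:
`1/(2G(t₀)) · (q/2)/(2G(t₁)) = q/(8G(t₀)G(t₁))`). [KontsevichZagier2001 §4.1; rule (1)] -/
theorem of_prod_arcRep_sub_of_sqRep_mem_relations (q : ℚ) :
    KZ.of ((arcRep 1).prod (arcRep (q / 2))) - KZ.of (sqRep q) ∈ KZ.relations := by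
  refine KZ.of_sub_of_mem_relations_of_eqOn ?_ fun z _ => ?_
  · rw [sqRep_domain, prod_arcRep_domain]
  · rw [KZ.IntegralRep.prod_integrand_eq, sqRep_integrand]
    simp only [KZ.IntegralRep.prodFun, arcRep_integrand]
    have e0 : z (Fin.castAdd 1 (0 : Fin 1)) = z 0 := rfl
    have e1 : z (Fin.natAdd 1 (0 : Fin 1)) = z 1 := rfl
    rw [e0, e1]
    have hG0 := (gPos (z 0)).ne'
    have hG1 := (gPos (z 1)).ne'
    push_cast
    field_simp
    ring

/-- **`[(0,1)⁴ ∩ {Σxᵢ² < 1}, q] − [arc, 1]·[arc, q/2] ∈ KZ.relations`:** the ball cell is a PRODUCT of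
two Baker generators modulo relations (five moves + the product structure).
[KontsevichZagier2001 §1.2, §4.1; this node] -/
theorem of_cell_sub_of_mul_mem_relations (q : ℚ) :
    KZ.of (cellRep ball4Poly q) - KZ.of (arcRep 1) * KZ.of (arcRep (q / 2)) ∈ KZ.relations := by
  rw [KZ.of_mul_of]
  have h1 := of_cell_sub_of_sqRep_mem_relations q
  have h2 := of_prod_arcRep_sub_of_sqRep_mem_relations q
  have : KZ.of (cellRep ball4Poly q) - KZ.of ((arcRep 1).prod (arcRep (q / 2))) =
      (KZ.of (cellRep ball4Poly q) - KZ.of (sqRep q)) -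
        (KZ.of ((arcRep 1).prod (arcRep (q / 2))) - KZ.of (sqRep q)) := by abel
  rw [this]
  exact sub_mem h1 h2

/-- The product class `[arc, 1]·[arc, q/2]` is a decomposable generator. [definition] -/
theorem mul_arcRep_mem_decompGens (q : ℚ) :
    KZ.of (arcRep 1) * KZ.of (arcRep (q / 2)) ∈ decompGens :=
  Or.inr ⟨1, 1, arcRep 1, arcRep (q / 2), le_rfl, le_rfl, isRational_arcRep _, isRational_arcRep _, rfl⟩

/-- **The 4-ball descends into the decomposable sector:** `QuadricDecompDescentAt ball4Poly`.
[KontsevichZagier2001 §1.2, §4.1; this node] -/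
theorem decompDescentAt_ball4 : QuadricDecompDescentAt ball4Poly := by
  intro q ρ hρ _
  refine ⟨KZ.of (arcRep 1) * KZ.of (arcRep (q / 2)),
    AddSubgroup.subset_closure (mul_arcRep_mem_decompGens q), ?_⟩
  have h0 : KZ.of ρ - KZ.of (cellRep ball4Poly q) ∈ KZ.relations :=
    KZ.of_sub_of_mem_relations_of_eqOn (by rw [hρ.1, cellRep_domain]) fun x hx => by
      rw [hρ.2 x hx, cellRep_integrand]
  have : KZ.of ρ - KZ.of (arcRep 1) * KZ.of (arcRep (q / 2)) =
      (KZ.of ρ - KZ.of (cellRep ball4Poly q)) +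
        (KZ.of (cellRep ball4Poly q) - KZ.of (arcRep 1) * KZ.of (arcRep (q / 2))) := by abel
  rw [this]
  exact add_mem h0 (of_cell_sub_of_mul_mem_relations q)

/-- **Conjecture 1 (kernel form) for every family of 4-ball cells `[(0,1)⁴ ∩ {Σxᵢ² < 1}, qᵢ]`, given
`DecomposableTwoKernel` only** — the oracle is asked only on products of arc classes, i.e. on
«`π²` versus the Baker span». [KontsevichZagier2001 §1.2, §4.1; this node] -/
theorem sum_mem_relations_ball4_of_decompKernel (hD : DecomposableTwoKernel) (k : ℕ) (q : Fin k → ℚ)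
    (ρ : Fin k → KZ.IntegralRep 4) (c : Fin k → ℤ)
    (hρ : ∀ i, (ρ i).domain = {x | (∀ j, 0 < x j ∧ x j < 1) ∧ 0 < MvPolynomial.aeval x ball4Poly} ∧
      ∀ x ∈ (ρ i).domain, (ρ i).integrand x = (q i : ℝ))
    (hv : KZ.eval (∑ i, c i • KZ.of (ρ i)) = 0) : (∑ i, c i • KZ.of (ρ i)) ∈ KZ.relations :=
  sum_mem_relations_four_of_decompDescentAt hD k (fun _ => ball4Poly) q ρ c
    (fun _ => decompDescentAt_ball4) hρ (fun _ => totalDegree_ball4Poly_le) hv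

end Summit.KontsevichZagierPeriods.RootDecompWalshStrata.DecompTwo

end
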